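import Summits.BirchSwinnertonDyer.Rank1Residual.ManinAdditive.NeronFLineDepth
import Literature.NumberTheory.EllipticCurves.HeckeOperators
import HarnessLib
import HarnessLib.Audit.Tags

/-!
# Candidates E-desc-33 / 31 / 32, the GIVEN row E-desc-28♯ and the support row `ConwayDepthTransfer`
# (desc g5, MEMO-desc §22): the CONWAY CUT at `2` — the half-translation `t = t_{1/2}`, the Conway-stable lattice
# `S^G`, the Katz–Mazur cusp lattice `L₄` — cell `bsd-f2-manin` (D-0131 (3) frontier: the Manin constant at
# additive primes). Sibling: `RamanujanCut` (the 3-adic cut, same sketch) and `ConwayRamanujanCutEdges`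
# (refuter-1's kernel lemmas RB61.1–61.5).

HONEST FRAMING. LENS = descent / visibility (planner `bsd-f2-manin-desc` g5; HOME
`run/shared/lean/pub/bsd-f2-manin/MEMO-desc.md` §22). Source: HOME/desc/Sketch-desc-g5.lean rev 2b sha16
**4994638152e2a41a** (farm rc 0 · 0 sorries per desc and per refuter-1 §R53), its 2-adic part (sketch lines
44–274), copied VERBATIM (namespace `DescG5` ↦ `…ManinAdditive.ConwayCut`) with exactly these deviations, all
recorded at the declaration: (i) `@[conjecture]` on the three law rows and on the support row (nothing is asserted);
(ii) refuter-1 §R53 recommendation 1 — the guard `4 ∣ N →` added to `ConwayDepthTransfer` and `(h4 : 4 ∣ N)`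
threaded through its three consequences; (iii) refuter-1 §R53 recommendation 2 — the print-status sentence of
`IsConwayNeronAtTwo` split by `v₂(N)`; (iv) four one-line docstrings added to undocumented lemmas; (v) rows
E-desc-29 `TameConwayTorsionLaw` and E-desc-30 `ConwayDefectOfIrreducible` are NOT FILED, deliberately: after
refuter-1's audit the owner's second engine MS-0 FALSIFIED both at the non-rational level `N = 92` (desc g6,
HOME/STATUS.md 2026-08-28T08:18:53Z: 92a1, Kodaira IV, `E(ℚ)[2] = 0`, `σ₂ = 0` where both rows predict `σ₂ = 1`;
E-desc-32/33 hold there); the surviving tame-cell reading «`σ₂ = [IV* ∧ E(ℚ)[2] = 0]`» (6/6 new + 16/16 census;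
imc A-imc-15) awaits re-typing by desc and a refuter pass, and will land under NEW names (append-only rule).
`HasRationalTwoTorsion` is kept as vocabulary for those repaired rows.

THE OBJECTS (tree declarations only; new E-blind objects on `S = S₂(Γ₀(N); ℤ)`):
* `halfTranslate N k` — the translation `t = t_{1/2} : f ↦ f(z + ½)`, `aₙ ↦ (−1)ⁿ aₙ`, an automorphism of
  `X₀(N)/ℚ` iff `4 ∣ N` (it normalises `Γ₀(N)`), typed like the tree's `w_Q` as a scalar multiple of the
  double-coset operator of `(2 1; 0 2) ∈ GL(2, ℚ)⁺` (refuter-1 §R53 P1: scalar `= 1` at `k = 2`, `t² = 1`);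
* `conwayStableLattice N = S^G` — the largest sublattice of `S` stable under every `w_{Q_p}` AND `t` (a MAX:
  refuter-1 RB61.1, Edges file); the Néron lattice `Λ = H⁰(𝒥₀(N), Ω¹)` lies in it (`Λ_le_conwayStableLattice`,
  from `t`-stability of `Λ` passed as a hypothesis — Néron mapping property for `t ∈ Aut_ℚ J₀(N)`), sharpening
  the landed `Λ ⊆ S^{AL}` (`NeronFLineDepth`);
* `kmCuspLattice N = L₄ = S ∩ w(S) ∩ t(w(S)) ∩ w(t(w(S)))`, `w = w_{2^{v₂(N)}}` — forms integral at the cusp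
  classes `∞, 0, ½, w(½)` over `2`;
* `HasRationalTwoTorsion`, `HasTwoTorsionInIdentityComponentAtTwo` — elementary predicates on a (globally minimal)
  Weierstrass model (refuter-1 §R53 P5: faithful in scope).
THE ROWS (candidate `Prop`s, `@[conjecture]`, nothing asserted; census of record (BC5) HOME/desc/CONWAY-mini-rows-g5.tsv
— 85 optimal newforms at the 33 all-rational levels `4 ∣ N ≤ 400`; engine MS-0 two-engine agreement 85/85 per desc g6
2026-08-28T08:18Z; `σ₂ := ord₂ deg φ − ord₂ [e_f S^G : ℤ f] ∈ {0,1}` everywhere): **E-desc-33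
`ConwayLatticeLocalAtTwo`** (33/33 levels), **E-desc-31 `ConwayFullOfIdentityComponentTorsion`** (47/47),
**E-desc-32 `ConwayDefectLeOne`** (85/85); the GIVEN-datum predicate **E-desc-28♯ `IsConwayNeronAtTwo Δ`**
(print-backed at `v₂(N) = 2` only — see its docstring); the support row **`ConwayDepthTransfer`** (theorem-candidate
at `4 ∣ N`, refuter-1 §R53 P7) and desc's PROVED consequences `not_two_dvd_maninConstant_of_conwayDepth`,
`lieSaturatedAt_two_of_conwayDepth`, `not_two_dvd_maninConstant_of_identityComponentTorsion` (the CHAIN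
E-desc-31 + GIVEN + transfer ⇒ `2 ∤ c_E` for 47 of the 85 census curves with no input from Cremona's tables).
WHY THE CELL WANTS THEM (§22; crux C2 `ManinOddAtFour` stmt-BirchSwinnertonDyer-22967): on the Néron `f`-line
`ord₂ c_E + ord₂ e₁ = ord₂ deg φ − ord₂ [e_f Λ : ℤ f]`; with E-desc-28♯ the right side becomes the E-BLIND
computable `σ₂`, so `σ₂ = 0` rows discharge `2 ∤ c_E` AND Lie saturation at `2`, and `σ₂ = 1` rows locate the
defect. Beyond-print theorem: no. BSD is not proved by this; Manin's conjecture is not proved by this.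

NOT IN PRINT as statements (desc presearch §22, corpus + galaxy; refuter-2 R-desc-10 NOT posted at filing): the
parity shadow of E-desc-30 IS in print (Calegari–Emerton 2009, Yazdani 2011 [corpus: paper:arxiv-0910.0571 p7,
p15]); the rational-singularity input of E-desc-28♯ is Česnavičius–Neururer–Saha [arXiv:1911.09446 p4 L10–16];
nobody replaces `S₂(ℤ)` by its `⟨w_Q, t⟩`-stable sublattice. REFUTER VERDICTS AT FILING (2026-08-28T08:28Z):
REF1 §R53 (R-desc-8/9/10, HOME/ref1/R53-ref1-desc-g5.md c6742c70ee41a6e6; kernel HOME/ref1-C61-desc-g5-audit.lean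
b4de42f85e3d09e2; probes 10/10 CLEAN): ALL rows SURVIVE as typed (on the all-rational census then available),
with the two typing notes folded here — refuter-1's kernel items RB61.1–61.3 land in the sibling Edges file;
REF2 R-desc-10 PENDING. Filed by the cell typer (T-desc-10, desc g5 07:17:06Z / 07:43:38Z, «after REF1's
R-desc-9 line»).
-/

noncomputable section

open scoped MatrixGroups ModularForm

open CongruenceSubgroup WeierstrassCurve Literature.NumberTheory.EllipticCurves.ModularForms
  Literature.NumberTheory.DiophantineGeometry

namespace Summit.BirchSwinnertonDyer.Rank1Residual.ManinAdditive.ConwayCut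

/-! ### The half-translation `t = t_{1/2}` and the Conway-stable lattice -/

section Operators

/-- The matrix `(2 1; 0 2) ∈ GL(2, ℚ)⁺` (determinant `4`), acting on `ℍ` as `z ↦ z + ½`; it normalises
`Γ₀(N)` iff `4 ∣ N`. [folklore] -/
def halfTranslateGL : GL(2, ℚ)⁺ :=
  ⟨Matrix.GeneralLinearGroup.mkOfDetNeZero !![2, 1; 0, 2] (by simp [Matrix.det_fin_two]),
    by simp [Matrix.det_fin_two]⟩

variable (N : ℕ) [NeZero N] (k : ℤ)

/-- The **half-translation** `t f = f(z + ½)` on `S_k(Γ₀(N))`, `4 ∣ N`: on `q`-expansions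
`aₙ ↦ (−1)ⁿ aₙ`.  Typed exactly like the tree's `atkinLehnerInvolution`: `4^{1−k/2}` times the double
coset operator `[Γ₀(N) (2 1; 0 2) Γ₀(N)]` (a single coset since the matrix normalises `Γ₀(N)` when
`4 ∣ N`; Mathlib's slash action carries `det^{k−1}`).  Junk (a genuine Hecke operator) if `4 ∤ N`. -/
def halfTranslate : CuspForm (Gamma0 N) k →ₗ[ℂ] CuspForm (Gamma0 N) k :=
  (((4 : ℝ) ^ (1 - (k : ℝ) / 2) : ℝ) : ℂ) • cuspHeckeOperatorₗ (Gamma0 N) k halfTranslateGL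

variable {N k}

variable (N) in
/-- `S^G`, the **Conway-stable lattice**: the largest `ℤ`-submodule of `S₂(Γ₀(N); ℤ)` stable under every
Atkin–Lehner involution `w_{Q_p}` AND the half-translation `t` (for `4 ∣ N` these generate the image of
the normaliser of `Γ₀(N)` in `Aut X₀(N)` at square-free odd part; Conway's "big picture").  The Néron
lattice `H⁰(𝒥₀(N), Ω¹)` lies inside it unconditionally. -/
def conwayStableLattice : Submodule ℤ (CuspForm (Gamma0 N) 2) :=
  sSup {M | M ≤ integralCuspForms0 N 2 ∧ (∀ p : ℕ, p.Prime → p ∣ N →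
    M.map ((atkinLehnerInvolutionAt N 2 p).restrictScalars ℤ) ≤ M) ∧
    M.map ((halfTranslate N 2).restrictScalars ℤ) ≤ M}

/-- `S^G ≤ S^{AL}` (the Conway-stable lattice is in particular Atkin–Lehner stable). (desc g5 VERBATIM.) -/
theorem conwayStableLattice_le_alStableLattice : conwayStableLattice N ≤ alStableLattice N :=
  sSup_le fun _ hM => le_sSup ⟨hM.1, hM.2.1⟩

/-- `S^G` is integral. (desc g5 VERBATIM.) -/
theorem conwayStableLattice_le : conwayStableLattice N ≤ integralCuspForms0 N 2 :=
  conwayStableLattice_le_alStableLattice.trans alStableLattice_le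

variable (N) in
/-- `L₄`, the **Katz–Mazur cusp lattice at `2`**: integral cusp forms whose transforms by `w = w_{2^{v₂(N)}}`,
`t ∘ w`, `w ∘ t ∘ w` are again integral, i.e. `q`-expansion integral at the cusp classes `∞, 0, ½, w(½)`.
For `v₂(N) ∈ {2,3}` these are all the components of the (reduced) Katz–Mazur fibre at `2`, and the census
finds `L₄ = S^{⟨w,t⟩}` on the nose at all 33 levels. -/
def kmCuspLattice : Submodule ℤ (CuspForm (Gamma0 N) 2) :=
  let S := integralCuspForms0 N 2
  let w := (atkinLehnerInvolutionAt N 2 2).restrictScalars ℤ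
  let t := (halfTranslate N 2).restrictScalars ℤ
  S ⊓ S.map w ⊓ (S.map w).map t ⊓ ((S.map w).map t).map w

/-- `L₄` is integral. (desc g5 VERBATIM.) -/
theorem kmCuspLattice_le : kmCuspLattice N ≤ integralCuspForms0 N 2 :=
  inf_le_left.trans (inf_le_left.trans inf_le_left)

end Operators

/-! ### Rational 2-torsion and its position in the Néron model at `2` (elementary typing) -/

/-- `E(ℚ)[2] ≠ 0`: the 2-division cubic `4x³ + b₂x² + 2b₄x + b₆` has a rational root. [folklore] -/
def HasRationalTwoTorsion (W : WeierstrassCurve ℚ) : Prop :=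
  ∃ x : ℚ, W.twoTorsionPolynomial.toPoly.eval x = 0

/-- Some rational 2-torsion point lies in the identity component `E⁰(ℚ₂)` of the Néron model: for a
globally minimal `W` this is the elementary condition "an integral point `(x, y)` with `2y + a₁x + a₃ = 0`
whose reduction mod `2` is a nonsingular point of `W mod 2`" (the smooth locus of the minimal model is
the identity component).  Stated with integer witnesses for the two partial derivatives. [folklore] -/
def HasTwoTorsionInIdentityComponentAtTwo (W : WeierstrassCurve ℚ) : Prop :=
  ∃ x y Fx Fy : ℤ, W.toAffine.Equation x y ∧ 2 * (y : ℚ) + W.a₁ * x + W.a₃ = 0 ∧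
    (Fx : ℚ) = W.a₁ * y - 3 * (x : ℚ) ^ 2 - 2 * W.a₂ * x - W.a₄ ∧ (Fy : ℚ) = W.a₁ * x + W.a₃ ∧
    ¬ (2 ∣ Fx ∧ 2 ∣ Fy)

/-! ### Candidate laws (census = HOME/desc/CONWAY-mini-rows-g5.tsv + CONWAY-levels-g5.txt; nothing asserted)

All laws are stated for the CONWAY lattice `S^G` (`σ₂ := ord₂ deg φ − ord₂ [e_f S^G : ℤ f]`, exact at every
level of the census); the census also shows `S^G ⊗ ℤ_(2) = S^{⟨w_{2^v},t⟩} ⊗ ℤ_(2) = L₄ ⊗ ℤ_(2)` at all 33 levels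
(`ConwayLatticeLocalAtTwo`), so on the reduced cells they are equally laws for the Katz–Mazur cusp lattice. -/

section Laws

open scoped Classical

/-- **E-desc-33 `ConwayLatticeLocalAtTwo`** (E-blind, `4 ∣ N`; census 33/33 LEVELS, lattice-level): the odd
Atkin–Lehner involutions cut only ODD index out of the 4-cusp lattice — every element of
`L₄ = S ∩ wS ∩ twS ∩ wtwS` has an odd multiple in the Conway-stable lattice `S^G`.  ("The Conway lattice is
local at 2.")  Why it might fail: an odd prime `q² ∣ N` whose `w_{q²}` mixes 2-adic congruence classes
(census has `q² ∣ N` only at `N ∈ {36,72,100,108,144,180,200,216,288,300,400}`), or a level with non-rational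
newforms where `S^G` is no longer generated by packets of eigenforms with integral eigenvalues.
VERBATIM HOME/desc/Sketch-desc-g5.lean 4994638152e2a41a `DescG5.ConwayLatticeLocalAtTwo` (nothing asserted).
REF1 §R53: SURVIVES (pure modular-curve statement, E-blind; `∃ n` odd excludes the junk `n = 0`; `S^G ≤ L₄` is
formal; probe CLEAN); REF2 R-desc-10: pending at filing.
[cite: KatzMazur1985, Ch. 13 (cusps and components of `X₀(N)` at `p ∣ N`) (shape only: «the Conway lattice is local at 2» is the cell's law E-desc-33, NOT in print — MEMO-desc §22; census 33/33 levels)] -/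
@[conjecture]
def ConwayLatticeLocalAtTwo : Prop :=
  ∀ (N : ℕ) [NeZero N], 4 ∣ N →
    ∀ g ∈ kmCuspLattice N, ∃ n : ℕ, Odd n ∧ (n : ℤ) • g ∈ conwayStableLattice N

/-- **E-desc-31 `ConwayFullOfIdentityComponentTorsion`** (every `4 ∣ N`; census 47/47: twenty on the reduced
cells `v₂(N) ≤ 3`, twenty-seven at `v₂(N) ≥ 4`): a rational 2-torsion point inside `E⁰(ℚ₂)` forces FULL depth,
`ord₂ [e_f S^G : ℤ f] = ord₂ deg φ`; modulo the GIVEN row this yields BOTH `2 ∤ c_E` AND Lie-saturation of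
`E → J₀(N)` at `2` with no appeal to Cremona's tables.  Why it might fail: the position of one torsion point
should not control a lattice index — the class "rational 2-torsion only through `Φ₂`" is split (56a1 `σ = 0`,
`P = 2Q`; 56b1, 120b1 `σ = 1`), and the sharp invariant is conjecturally "some rational 2-torsion point maps
into `2Φ₂`" (`Φ₂ = E(ℚ₂)/E⁰(ℚ₂)`), which this typing under-approximates.
VERBATIM HOME/desc/Sketch-desc-g5.lean 4994638152e2a41a `DescG5.ConwayFullOfIdentityComponentTorsion` (nothing asserted).
REF1 §R53: SURVIVES; the integer-witness typing of «2-torsion in `E⁰(ℚ₂)`» is FAITHFUL in scope (additive at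
`2` on a minimal model forces `a₁` even, so every rational 2-torsion point is integral; `Fy = −2y` is even, the
clause is «`Fx` odd»; 0/897 670 optimal `4 ∣ N` curves have odd `a₁`); probe CLEAN; REF2: pending at filing.
[cite: CesnaviciusNeururerSaha2023, Thm. 1.2 (shape only: Manin at `2` via the Néron lattice; the full-depth law for identity-component torsion is the cell's law E-desc-31, NOT in print — MEMO-desc §22; census 47/47)] -/
@[conjecture]
def ConwayFullOfIdentityComponentTorsion : Prop :=
  ∀ (W : WeierstrassCurve ℚ) [W.IsElliptic] [W.IsGloballyMinimal] [NeZero (W.conductorNorm ℤ)]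
    (D : ModularParametrizationData W (W.conductorNorm ℤ)),
    (∀ z ∈ D.L.lattice, ∃ w ∈ periodLattice D.f, z = D.c * w) →
    (∀ (W' : WeierstrassCurve ℚ) [W'.IsElliptic]
        (D' : ModularParametrizationData W' (W.conductorNorm ℤ)),
        D'.f = D.f → D.modularDegree ≤ D'.modularDegree) →
    4 ∣ W.conductorNorm ℤ → HasTwoTorsionInIdentityComponentAtTwo W →
      padicValNat 2 (lineIndex (conwayStableLattice (W.conductorNorm ℤ)) D.f) =
        padicValNat 2 D.modularDegree

/-- **E-desc-32 `ConwayDefectLeOne`** (E-facing dichotomy, every `4 ∣ N`; census 85/85): the Conway-stable lattice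
loses AT MOST ONE factor `2` of the modular-degree congruence on an optimal `f`-line:
`ord₂ deg φ ≤ ord₂ [e_f S^G : ℤ f] + 1`.  Why it might fail: deep oldform congruences at `2^8 ∣ N` or CM levels
could cut two factors (`σ₂ = 2` never seen for `N ≤ 400`).
VERBATIM HOME/desc/Sketch-desc-g5.lean 4994638152e2a41a `DescG5.ConwayDefectLeOne` (nothing asserted).
REF1 §R53: SURVIVES (`≤`-shape, junk-safe: `lineIndex = 0` only makes the row harder; consistent with E-desc-26′
∧ `S^G ≤ S ∩ w₄S`; probe CLEAN); REF2: pending at filing.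
[cite: AgasheRibetStein2012, Thm. 2.1 (shape only: congruence number vs modular degree; the one-factor bound for the Conway-stable lattice is the cell's law E-desc-32, NOT in print — MEMO-desc §22; census 85/85)] -/
@[conjecture]
def ConwayDefectLeOne : Prop :=
  ∀ (W : WeierstrassCurve ℚ) [W.IsElliptic] [W.IsGloballyMinimal] [NeZero (W.conductorNorm ℤ)]
    (D : ModularParametrizationData W (W.conductorNorm ℤ)),
    (∀ z ∈ D.L.lattice, ∃ w ∈ periodLattice D.f, z = D.c * w) →
    (∀ (W' : WeierstrassCurve ℚ) [W'.IsElliptic]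
        (D' : ModularParametrizationData W' (W.conductorNorm ℤ)),
        D'.f = D.f → D.modularDegree ≤ D'.modularDegree) →
    4 ∣ W.conductorNorm ℤ →
      padicValNat 2 D.modularDegree ≤
        padicValNat 2 (lineIndex (conwayStableLattice (W.conductorNorm ℤ)) D.f) + 1

end Laws

/-! ### The GIVEN-datum row: the Néron lattice at `2` IS the Conway lattice (E-desc-28♯) -/

section Given

variable {N : ℕ} [NeZero N] {W : WeierstrassCurve ℚ} [W.IsElliptic]
  {D : ModularParametrizationData W N} (Δ : NeronFLineDatum W D)

/-- `Λ ≤ S^G` — the Conway sharpening of the landed `Λ_le_alStableLattice`, from `t`-stability of `Λ`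
(Néron mapping property for `t ∈ Aut_ℚ J₀(N)`, `4 ∣ N`; a printed fact, passed as a hypothesis). -/
theorem Λ_le_conwayStableLattice
    (ht : Δ.Λ.map ((halfTranslate N 2).restrictScalars ℤ) ≤ Δ.Λ) :
    Δ.Λ ≤ conwayStableLattice N :=
  le_sSup ⟨Δ.Λ_le, Δ.map_atkinLehner_le, ht⟩

/-- **`IsConwayNeronAtTwo`** (GIVEN-datum predicate E-desc-28♯; nothing asserted): every element of the
Conway lattice has an ODD multiple in the Néron lattice, i.e. `Λ ⊗ ℤ_(2) = S^G ⊗ ℤ_(2)` given `Λ ≤ S^G`.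
PRINT STATUS (refuter-1 §R53 rec. 2, replacing the sketch's uniform «`v₂(N) ∈ {2,3}`»): the printed inputs —
`X₀(N)_{ℤ_(2)}` has rational singularities, so `Pic⁰_{X₀(N)/ℤ_(2)} = 𝒥₀(N)⁰` and `Λ ⊗ ℤ_(2) = H⁰(X₀(N)_{ℤ_(2)}, Ω)`
is cut out by explicit bounds on `q`-expansions at ALL cusps (Česnavičius–Neururer–Saha, Thm. 1.2 with the
rational-singularity criterion p. 4 L10–16: at `p = 2` iff `v₂(N) ≤ 2` or some prime `p' ≡ 3 (mod 4)` divides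
`N`), plus transitivity of `⟨w_Q, t⟩` on the `2`-cusps for `v₂(N) ∈ {2,3}` (Katz–Mazur multiplicities `1`) —
make this predicate PRINT-BACKED at `v₂(N) = 2`; at `v₂(N) = 3` it is CONDITIONAL on `∃ p' ∣ N`,
`p' ≡ 3 (mod 4)` (e.g. `N = 40, 136` uncovered); at `v₂(N) ≥ 4` (component `(2,2)` of multiplicity `2`) it
is CONJECTURAL.  The predicate has teeth: the junk datum `Λ = ⊥` is excluded as soon as `S^G ≠ 0`
(refuter-1 RB61.3 `not_isConwayNeronAtTwo_of_Λ_eq_bot`, sibling Edges file).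
[cite: CesnaviciusNeururerSaha2023, Thm. 1.2 and p. 4 L10–16 (rational singularities at 2) (shape only: the identification of the Néron lattice with the Conway-stable lattice is the cell's GIVEN row E-desc-28♯, NOT in print — MEMO-desc §22)] -/
def IsConwayNeronAtTwo : Prop :=
  Δ.Λ ≤ conwayStableLattice N ∧ ∀ g ∈ conwayStableLattice N, ∃ n : ℕ, Odd n ∧ (n : ℤ) • g ∈ Δ.Λ

end Given

/-- **Support statement `ConwayDepthTransfer`** (finite-index lattice bookkeeping; a THEOREM-CANDIDATE, not
proved here — refuter-1 §R53 P7: TRUE on paper at `4 ∣ N` (`a₂ = 0 ⇒ t f = −f`, `w_{Q_p} f = ±f ⇒ ℤf ≤ S^G`,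
`e_f S^G` cyclic; in-kernel ≈ 150–300 lines), so a prover lands `ConwayDepthTransfer_holds` in a sibling file):
if `4 ∣ N`, the Néron lattice is the Conway lattice at `2` and `S^G` has full depth on the `f`-line, then the
datum has Néron congruence depth at `2`.  DEVIATION from the sketch (refuter-1 §R53 rec. 1, folded by the typer):
the guard `4 ∣ N →` is added — at `4 ∤ N` the operator `t` is a genuine level-raising coset operator, `f ∉ S^G`
in general, and the unguarded `∀ N` statement «can hold with a different meaning» (its truth is not settled). -/
@[conjecture]
def ConwayDepthTransfer : Prop :=
  ∀ (N : ℕ) [NeZero N] (W : WeierstrassCurve ℚ) [W.IsElliptic] (D : ModularParametrizationData W N)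
    (Δ : NeronFLineDatum W D), 4 ∣ N → IsConwayNeronAtTwo Δ →
    padicValNat 2 (lineIndex (conwayStableLattice N) D.f) = padicValNat 2 D.modularDegree →
    lineIndex (conwayStableLattice N) D.f ≠ 0 → Δ.NeronCongruenceDepthAt 2

/-- The Manin consequence, assembled from `ConwayDepthTransfer` and the landed interface theorem
`NeronFLineDatum.not_dvd_maninConstant_of_depth`: under the GIVEN row and full Conway depth, `2 ∤ c_E`
(and, by `lieSaturatedAt_of_depth`, `E → J₀(N)` is Lie-saturated at `2`). (desc g5, PROVED; `h4 : 4 ∣ N`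
threaded per refuter-1 §R53 rec. 1.) -/
theorem not_two_dvd_maninConstant_of_conwayDepth (hT : ConwayDepthTransfer) {N : ℕ} [NeZero N]
    {W : WeierstrassCurve ℚ} [W.IsElliptic] {D : ModularParametrizationData W N}
    (Δ : NeronFLineDatum W D) (h4 : 4 ∣ N) (hΛ : IsConwayNeronAtTwo Δ)
    (hfull : padicValNat 2 (lineIndex (conwayStableLattice N) D.f) = padicValNat 2 D.modularDegree)
    (hfin : lineIndex (conwayStableLattice N) D.f ≠ 0) :
    ¬ (2 : ℤ) ∣ D.maninConstant :=
  haveI : Fact (Nat.Prime 2) := ⟨Nat.prime_two⟩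
  Δ.not_dvd_maninConstant_of_depth (hT N W D Δ h4 hΛ hfull hfin)

/-- … and Lie saturation of `E → J₀(N)` at `2` under the same hypotheses (`lieSaturatedAt_of_depth`).
(desc g5; `h4` threaded per refuter-1 §R53 rec. 1.) -/
theorem lieSaturatedAt_two_of_conwayDepth (hT : ConwayDepthTransfer) {N : ℕ} [NeZero N]
    {W : WeierstrassCurve ℚ} [W.IsElliptic] {D : ModularParametrizationData W N}
    (Δ : NeronFLineDatum W D) (h4 : 4 ∣ N) (hΛ : IsConwayNeronAtTwo Δ)
    (hfull : padicValNat 2 (lineIndex (conwayStableLattice N) D.f) = padicValNat 2 D.modularDegree)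
    (hfin : lineIndex (conwayStableLattice N) D.f ≠ 0) :
    Δ.LieSaturatedAt 2 :=
  haveI : Fact (Nat.Prime 2) := ⟨Nat.prime_two⟩
  Δ.lieSaturatedAt_of_depth (hT N W D Δ h4 hΛ hfull hfin)

/-- The CHAIN for the identity-component class (E-desc-31 + GIVEN + transfer ⇒ Manin at 2), as one implication:
this is the shape in which the Conway cut would discharge `2 ∤ c_E` for 47 of the 85 census curves with NO
input from Cremona's tables. -/
theorem not_two_dvd_maninConstant_of_identityComponentTorsion
    (hLaw : ConwayFullOfIdentityComponentTorsion) (hT : ConwayDepthTransfer)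
    (W : WeierstrassCurve ℚ) [W.IsElliptic] [W.IsGloballyMinimal] [NeZero (W.conductorNorm ℤ)]
    (D : ModularParametrizationData W (W.conductorNorm ℤ)) (Δ : NeronFLineDatum W D)
    (hL : ∀ z ∈ D.L.lattice, ∃ w ∈ periodLattice D.f, z = D.c * w)
    (hopt : ∀ (W' : WeierstrassCurve ℚ) [W'.IsElliptic]
        (D' : ModularParametrizationData W' (W.conductorNorm ℤ)),
        D'.f = D.f → D.modularDegree ≤ D'.modularDegree)
    (h4 : 4 ∣ W.conductorNorm ℤ) (htors : HasTwoTorsionInIdentityComponentAtTwo W)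
    (hΛ : IsConwayNeronAtTwo Δ)
    (hfin : lineIndex (conwayStableLattice (W.conductorNorm ℤ)) D.f ≠ 0) :
    ¬ (2 : ℤ) ∣ D.maninConstant :=
  not_two_dvd_maninConstant_of_conwayDepth hT Δ h4 hΛ (hLaw W D hL hopt h4 htors) hfin

end Summit.BirchSwinnertonDyer.Rank1Residual.ManinAdditive.ConwayCut
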